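/-
Origin: expansion seat `planner-pub-hodgecm-qw8b-g6-0`, handover #1 2026-08-18T11:05:56Z (window to 11:11:38Z) (`HOME/pub-hodgecm-qw8b-g6/lean/Qw8b6/Qw8NoN3.lean`, md5 d9524ee5, 357 lines);
landed by the gen-7 packager in gate run 28 as `HodgeCM/StubTree/Qw8NoN3.lean` (verbatim).
-/
/-
Copyright: pub-hodgecm formalisation cell (harness21, 2026). New file (not vendored).
Origin: HOME/pub-hodgecm-qw8b-g6/lean/Qw8b6/Qw8NoN3.lean — session planner-pub-hodgecm-qw8b-g6-0 (unit pub-hodgecm-qw8b-g6,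
QW8 SEAT 2, part (6b)(ii), generation 6).  WIP module `Qw8b6.Qw8NoN3`; intended final place `HodgeCM/StubTree/Qw8NoN3.lean`
(module `HodgeCM.StubTree.Qw8NoN3`).  ADDITIVE LEAF: replaces nothing, nothing imports it.  Imports: three LANDED modules only
(`HodgeCM.StubTree.Qw8NoN4`, gate run 27; `HodgeCM.Proofs.Pohlmann.UnitH0Connected`, run 26; `HodgeCM.Proofs.Pohlmann.PohlmannNoN4`,
run 27); no WIP import, nothing to rewrite.
Scope note (for the input tables).  N3 `Fact_pull_H0` (M33: `f^* = id` on `H⁰(X, ℚ)` for EVERY `X` and every `f : X → X`):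
every DIRECT use of N3 in the landed run-27 tree outside `Model/` (WeightSpan :251, WeightHodge :231, DegreeZero :90/:128/:253,
PohlmannNoN4 :169, AnyCMFieldNoN4 :243, Qw8Milne :409, Qw8MilneZero :80/:109, Qw8Monomial :762, Qw8GysinDescent :696,
DegreeZeroGeneric :185, DegreeZeroDescent :106) is `U.pull Ma 0 = id` for a factor-wise CM multiplication `Ma : A′ → A′` of a CM
product `A′ = ∏_j A_{(F,Θ_j)}`; the cone below `Assembly.COR_CM_of_descentFactsB₃` reaches N3 through exactly two of them —
`isWeightVector_zero` (M29 in degree 0; also via `qw8MilneZero_of_descent`) and `pohlmannSpanAt_zero_of_pull_H0` (the level-0 span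
inclusion).  The CM-product instance `Fact_pull_H0_cmProd` is a THEOREM of F-H0 `Fact_unitH0` (M43:
`H⁰(A′, ℚ) = ℚ·1`, `f^* 1 = 1`; qw8b-g3 `pull_H0_cmProd_of_unitH0`, UnitH0Connected.lean), so on route (δ) = F-H0 + F7d-B, where
M43 is already a binder, N3 is REDUNDANT: the [QW8]-side end-to-end theorem reads
`HC_CM ⇐ ModelAxioms ∧ RealisationExistsFace ∧ N1 ∧ N2 ∧ F4 ∧ F5 ∧ F-H0 ∧ F7d-B ∧ Fact_dimProd` (TEN binders,
`Assembly.COR_CM_of_descentFactsB₄`; the run-27 `COR_CM_of_descentFactsB₃` has eleven, the run-25 `COR_CM_of_descentFactsB` twelve).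
On route (γ) = F7d (no M43 among the binders) N3 weakens to `Fact_pull_H0_cmProd` but does not disappear.  N3 stays load-bearing,
as typed, off the CM products (objects `HC_CM` never mentions) and is NOT implied by the ten binders as a statement about all
`X` (no separating model is claimed here: toy2-g5's `twoPadModel` violates N3 AND F-H0).  Nothing is cited; Lean + Mathlib axioms
only; no landed declaration is restated or shadowed (all names are new, suffixed `₄` / `_cmProd`).
-/
import Summits.HodgeConjecture.HodgeCM.StubTree.Qw8NoN4
import Summits.HodgeConjecture.HodgeCM.Proofs.Pohlmann.UnitH0Connected
import Summits.HodgeConjecture.HodgeCM.Proofs.Pohlmann.PohlmannNoN4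

/-!
# The [QW8] half of COR-CM without N3 `Fact_pull_H0`: ten binders on route (δ)

After `HodgeCM.StubTree.Qw8NoN4` (qw8b-g5, run 27) the [QW8]-side end-to-end theorem is
`Assembly.COR_CM_of_descentFactsB₃ (U) (M) (hR) (hN1) (hN2) (hN3) (h4) (h5) (hu) (hb) (hd) : U.HC_CM` — eleven binders, among
them BOTH N3 `Fact_pull_H0` (`f^* = id` on `H⁰(X, ℚ)`, all `X`) and F-H0 `Fact_unitH0` (unit classes; `H⁰(A′, ℚ) = ℚ · 1_{A′}`
for the CM products `A′`).  The cone below `COR_CM_of_descentFactsB₃` instantiates N3 only at CM products (`hN3 _ Ma` with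
`Ma : A′ → A′` a factor-wise CM multiplication, in `isWeightVector_zero` and `pohlmannSpanAt_zero_of_pull_H0`), and that instance
follows from F-H0 (`pull_H0_cmProd_of_unitH0`, qw8b-g3, run 26: `f^* (r • 1) = r • f^* 1 = r • 1`).  This file re-threads the
cone over the CM-product instance:

* §0 `Universe.Fact_pull_H0_cmProd` (N3 at CM products) with `fact_pull_H0_cmProd_of_pull_H0` (from N3) and
  `fact_pull_H0_cmProd_of_unitH0` (from F-H0);
* §1 M29 `Fact_weightSpan` from `ModelAxioms` + N1 + `Fact_pull_H0_cmProd`: `isWeightVector_zero₄`, `iSup_weightSpace_zero₄`,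
  `weightSpan_of_facts₄`; hence `weightSpan_of_unitH0 (M) (hN1) (hu)`;
* §2 `PohlmannSpan` from `ModelAxioms` + N1 + N2 + `Fact_pull_H0_cmProd`: `pohlmannSpanAt_zero₄`, `pohlmannSpan_of_facts₄`;
  hence `pohlmannSpan_of_unitH0 (M) (hN1) (hN2) (hu)`;
* §3 `Qw8MilnePos` from `ModelAxioms` + N1 + N2 + F4 + F5 + M29-as-a-Prop: `weightSpace_le_algC_of_lefChar_eq_zero₄`,
  `qw8MilnePos_of_weightSpan (M) (hN1) (hN2) (h29) (h4) (h5)`, `qw8MilnePos_of_facts₄`, `qw8MilnePos_of_unitH0`;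
* §4 `Qw8MilneZero` by descent with `Fact_pull_H0_cmProd`: `qw8MilneZero_of_descent₄` (the proof of `qw8MilneZero_of_descent`
  verbatim, `isWeightVector_zero` ↦ `isWeightVector_zero₄`);
* §5 the two trace-free routes: `qw8Sufficiency_of_descentFacts₄` / `qw8Milne_of_descentFacts₄` (route (γ), binder
  `Fact_pull_H0_cmProd`), `qw8Sufficiency_of_unitH0₄` / `qw8Milne_of_unitH0₄` (route (δ), NO N3-type binder);
* §6 `Assembly.COR_CM_of_descentFacts₄` (route (γ)) and **`Assembly.COR_CM_of_descentFactsB₄ (U) (M) (hR) (hN1) (hN2) (h4) (h5)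
  (hu) (hb) (hd) : U.HC_CM`** (route (δ), ten binders), with `COR_CM_of_descentFactsB₃` recovered as the special case that
  ignores its `hN3`.
-/

noncomputable section

open scoped TensorProduct NumberField Classical

namespace HodgeCM

open Literature.AlgebraicGeometry.Motives (CMType HodgeStructure)
open Literature.AlgebraicGeometry.Motives.HodgeStructure (ofRat ofRat_apply)
open HodgeCM.Pohlmann

namespace Universe

/-! ## 0. N3 at CM products -/

/-- **N3 at CM products**: every endomorphism `f : A′ → A′` of a CM product `A′ = ∏_j A_{(F,Θ_j)}` acts as the identity on
`H⁰(A′, ℚ)`.  The only instances of N3 `Fact_pull_H0` the [QW8] / Pohlmann cone consumes; a theorem of F-H0 `Fact_unitH0`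
(`fact_pull_H0_cmProd_of_unitH0`). -/
def Fact_pull_H0_cmProd (U : Universe) : Prop :=
  ∀ (F : CMField) (n : ℕ) (Θ : Fin (n + 1) → CMType F) (f : U.Mor (U.cmProd F Θ) (U.cmProd F Θ)),
    U.pull f 0 = LinearMap.id

variable {U : Universe}

/-- N3 ⇒ N3 at CM products (instance). -/
theorem fact_pull_H0_cmProd_of_pull_H0 (hN3 : U.Fact_pull_H0) : U.Fact_pull_H0_cmProd := fun F _ Θ f =>
  hN3 (U.cmProd F Θ) f

/-- **F-H0 ⇒ N3 at CM products** (`H⁰(A′, ℚ) = ℚ · 1`, `f^* 1 = 1`; qw8b-g3 `pull_H0_cmProd_of_unitH0`). -/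
theorem fact_pull_H0_cmProd_of_unitH0 (hu : U.Fact_unitH0) : U.Fact_pull_H0_cmProd := fun F _ Θ f =>
  pull_H0_cmProd_of_unitH0 hu F Θ f

/-! ## 1. M29 `Fact_weightSpan` without N3 -/

section CM

variable {F : CMField} {n : ℕ} {Θ : Fin (n + 1) → CMType F}

/-- On `H⁰(A′, ℂ)` every factor-wise CM multiplication acts trivially (N3 at CM products), so every class has weight
`(∅)_j` (compare `isWeightVector_zero`, which takes the full N3). -/
theorem isWeightVector_zero₄ (h3 : U.Fact_pull_H0_cmProd) (y : U.CohC (U.cmProd F Θ) 0) :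
    U.IsWeightVector F Θ (fun _ => ∅) 0 y := by
  intro j a Ma _
  simp only [Finset.prod_empty, one_smul]
  show (U.pull Ma 0).baseChange ℂ y = y
  rw [h3 F n Θ Ma, LinearMap.baseChange_id]
  rfl

/-- (Ported verbatim from the HodgeCMPerL package; no docstring in the source.) -/
theorem iSup_weightSpace_zero₄ (h3 : U.Fact_pull_H0_cmProd) : ⨆ S, U.weightSpace F Θ S 0 = ⊤ :=
  eq_top_iff.2 fun y _ =>
    Submodule.mem_iSup_of_mem (fun _ => ∅) ((mem_weightSpace_iff _ _ _ _ _).2 (isWeightVector_zero₄ h3 y))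

end CM

/-- **M29 `Fact_weightSpan` is a theorem of `ModelAxioms` + N1 + N3-at-CM-products** (compare `weightSpan_of_facts`). -/
theorem weightSpan_of_facts₄ (M : U.ModelAxioms) (hN1 : U.Fact_cupExterior) (h3 : U.Fact_pull_H0_cmProd) :
    U.Fact_weightSpan := by
  intro F n Θ k
  cases k with
  | zero => exact iSup_weightSpace_zero₄ h3
  | succ k => exact iSup_weightSpace_succ M hN1 k

/-- **M29 from `ModelAxioms` + N1 + F-H0** — no N3. -/
theorem weightSpan_of_unitH0 (M : U.ModelAxioms) (hN1 : U.Fact_cupExterior) (hu : U.Fact_unitH0) : U.Fact_weightSpan :=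
  weightSpan_of_facts₄ M hN1 (fact_pull_H0_cmProd_of_unitH0 hu)

/-! ## 2. `PohlmannSpan` without N3 -/

/-- **The level-`0` span inclusion from N3 at CM products** (compare `pohlmannSpanAt_zero_of_pull_H0`). -/
theorem pohlmannSpanAt_zero₄ (h3 : U.Fact_pull_H0_cmProd) (F : CMField) (n : ℕ) (Θ : Fin (n + 1) → CMType F) :
    (U.hodgeClassesOf (U.cmProd F Θ) 0).map ofRat ≤
      (Submodule.span ℂ {x : U.CohC (U.cmProd F Θ) (2 * 0) |
          ∃ S : Fin (n + 1) → Finset ((F : Type) →+* ℂ),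
            IsHodgeWeight Θ 0 S ∧ U.IsWeightVector F Θ S (2 * 0) x}).restrictScalars ℚ := by
  rintro y -
  rw [Submodule.restrictScalars_mem]
  refine Submodule.subset_span ⟨fun _ => ∅, ⟨by simp, fun P => by simp⟩, fun j a Ma _ => ?_⟩
  rw [Finset.prod_empty, one_smul]
  have h : U.pull Ma (2 * 0) = LinearMap.id := h3 F n Θ Ma
  show (U.pull Ma (2 * 0)).baseChange ℂ y = y
  rw [h, LinearMap.baseChange_id]
  rfl

/-- **Pohlmann's span theorem from `ModelAxioms` + N1 + N2 + N3-at-CM-products** (compare `pohlmannSpan_of_facts₃`). -/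
theorem pohlmannSpan_of_facts₄ (M : U.ModelAxioms) (hN1 : U.Fact_cupExterior) (hN2 : U.Fact_cup_hodge)
    (h3 : U.Fact_pull_H0_cmProd) : U.PohlmannSpan := by
  intro F hG _h6 n Θ p
  cases p with
  | zero => exact pohlmannSpanAt_zero₄ h3 F n Θ
  | succ q =>
    exact pohlmannSpanAt_of_weightHodgeAt M (weightSpan_of_facts₄ M hN1 h3) (q + 1)
      (weightHodgeAt_of_facts_of_pos M hN1 hN2 (by omega)) F n Θ

/-- **`PohlmannSpan` from `ModelAxioms` + N1 + N2 + F-H0** — no N3, no N4. -/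
theorem pohlmannSpan_of_unitH0 (M : U.ModelAxioms) (hN1 : U.Fact_cupExterior) (hN2 : U.Fact_cup_hodge)
    (hu : U.Fact_unitH0) : U.PohlmannSpan :=
  pohlmannSpan_of_facts₄ M hN1 hN2 (fact_pull_H0_cmProd_of_unitH0 hu)

/-! ## 3. `Qw8MilnePos` with M29 as a hypothesis (no N3) -/

section Milne

variable {F : CMField} {n : ℕ} {Θ : Fin (n + 1) → CMType F}

/-- **Weight spaces with vanishing Lefschetz character are algebraic** (positive degree `k + 1 = 2(m+1)`), from
`ModelAxioms`, N1, N2, F4, F5 and M29 `Fact_weightSpan` AS A HYPOTHESIS — the proof of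
`weightSpace_le_algC_of_lefChar_eq_zero₃` verbatim with `weightSpan_of_facts M hN1 hN3` replaced by `h29`. -/
theorem weightSpace_le_algC_of_lefChar_eq_zero₄ [IsGalois ℚ F] (M : U.ModelAxioms) (hN1 : U.Fact_cupExterior)
    (hN2 : U.Fact_cup_hodge) (h29 : U.Fact_weightSpan) (h4 : U.Fact_cupAlg) (h5 : U.Fact_cupAssoc) (m k : ℕ)
    (hk : k + 1 = 2 * (m + 1)) {S : Fin (n + 1) → Finset ((F : Type) →+* ℂ)} (hS : lefChar Θ S = 0) :
    U.weightSpace F Θ S (k + 1) ≤ (U.algC (U.cmProd F Θ) (m + 1)).comap (U.castC (U.cmProd F Θ) hk).toLinearMap := by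
  have h30 : U.Fact_weightHodgeAt (2 * 1) := weightHodgeAt_succ_of_facts M hN1 hN2 1
  refine weightSpace_le_of_fmono_mem M hN1 k S _ fun x hx p hp hpS => ?_
  rw [Submodule.mem_comap]
  show U.castC _ hk (U.cupPowC (U.cmProd F Θ) k (U.fvec x ∘ p)) ∈ U.algC (U.cmProd F Θ) (m + 1)
  refine castC_cupPowC_mem_algC barCM h4 h5 (fun k => hN1 F n Θ k) (fun Ψ => barCM_barCM Ψ) barCM_ne_self
    m k hk (U.fvec x ∘ p) (fun i => pullType (Θ (p i).1) (p i).2) ?_ ?_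
  · intro i l hτ
    exact cupC_fvec_mem_algC_of_weightHodgeAt x M h29 h30 hx (p i) (p l) hτ
  · intro Ψ
    have hb := lefChar_eq_zero_balanced Θ S hS Ψ
    have hb' : (∑ j, ∑ s ∈ S j, if pullType (Θ j) s = Ψ then (1 : ℤ) else 0) =
        ∑ j, ∑ s ∈ S j, if pullType (Θ j) s = barCM Ψ then (1 : ℤ) else 0 := by
      have h' := congrArg (Nat.cast : ℕ → ℤ) hb
      simp only [Nat.cast_sum, Finset.natCast_card_filter] at h'
      convert h' using 3
    rw [← hpS, ← sum_eq_sum_wtOf p hp (fun j s => if pullType (Θ j) s = Ψ then (1 : ℤ) else 0),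
      ← sum_eq_sum_wtOf p hp (fun j s => if pullType (Θ j) s = barCM Ψ then (1 : ℤ) else 0)] at hb'
    convert hb' using 3

end Milne

/-- **`Qw8Milne` in positive degree is a theorem of `ModelAxioms` (M1–M28), N1, N2, F4, F5 and M29 `Fact_weightSpan`**
(compare `qw8MilnePos_of_facts₃`: same proof with `weightSpace_le_algC_of_lefChar_eq_zero₄`). -/
theorem qw8MilnePos_of_weightSpan (M : U.ModelAxioms) (hN1 : U.Fact_cupExterior) (hN2 : U.Fact_cup_hodge)
    (h29 : U.Fact_weightSpan) (h4 : U.Fact_cupAlg) (h5 : U.Fact_cupAssoc) : U.Qw8MilnePos := by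
  intro F hG _h6 z hp hz
  obtain ⟨n, Θ, p, S, x, hx0, hxw⟩ := z
  change 0 < p at hp
  change lefChar Θ S = 0 at hz
  change x ∈ U.algC (U.cmProd F Θ) p
  obtain ⟨m, rfl⟩ : ∃ m, p = m + 1 := ⟨p - 1, by omega⟩
  have hk : 2 * m + 1 + 1 = 2 * (m + 1) := by ring
  have hx' : U.castC _ hk.symm x ∈ U.weightSpace F Θ S (2 * m + 1 + 1) :=
    (U.mem_weightSpace_iff F Θ S _ _).2 (U.isWeightVector_castC F Θ S hk.symm hxw)
  have h := weightSpace_le_algC_of_lefChar_eq_zero₄ M hN1 hN2 h29 h4 h5 m (2 * m + 1) hk hz hx'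
  rw [Submodule.mem_comap, LinearEquiv.coe_coe, castC_castC, castC_self] at h
  exact h

/-- `Qw8MilnePos` from `ModelAxioms`, N1, N2, N3-at-CM-products, F4, F5. -/
theorem qw8MilnePos_of_facts₄ (M : U.ModelAxioms) (hN1 : U.Fact_cupExterior) (hN2 : U.Fact_cup_hodge)
    (h3 : U.Fact_pull_H0_cmProd) (h4 : U.Fact_cupAlg) (h5 : U.Fact_cupAssoc) : U.Qw8MilnePos :=
  qw8MilnePos_of_weightSpan M hN1 hN2 (weightSpan_of_facts₄ M hN1 h3) h4 h5

/-- **`Qw8MilnePos` from `ModelAxioms`, N1, N2, F4, F5, F-H0** — no N3, no N4. -/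
theorem qw8MilnePos_of_unitH0 (M : U.ModelAxioms) (hN1 : U.Fact_cupExterior) (hN2 : U.Fact_cup_hodge)
    (h4 : U.Fact_cupAlg) (h5 : U.Fact_cupAssoc) (hu : U.Fact_unitH0) : U.Qw8MilnePos :=
  qw8MilnePos_of_facts₄ M hN1 hN2 (fact_pull_H0_cmProd_of_unitH0 hu) h4 h5

/-! ## 4. `Qw8MilneZero` by descent, N3 at CM products only -/

/-- **`Qw8MilneZero` from `ModelAxioms`, N1, N3-at-CM-products, F7d, `Fact_dimProd` and `Qw8MilnePos`** — the proof of
`qw8MilneZero_of_descent` verbatim with `isWeightVector_zero hN3` ↦ `isWeightVector_zero₄ h3` (its one use of N3, at the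
CM product `∏ A_{Ξ_j}`). -/
theorem qw8MilneZero_of_descent₄ (M : U.ModelAxioms) (hN1 : U.Fact_cupExterior) (h3 : U.Fact_pull_H0_cmProd)
    (hd : U.Fact_dimProd) (h7d : U.Fact_gysinDescent) (hpos : U.Qw8MilnePos) : U.Qw8MilneZero := by
  intro F hG h6 z hzp
  obtain ⟨n, Θ, p, S, x, hx0, hxw⟩ := z
  change p = 0 at hzp
  subst hzp
  change x ∈ U.algC (U.cmProd F Θ) 0
  let Θ' : Fin (0 + 1) → CMType F := fun _ => Θ 0
  let Ξ : Fin (n + 1 + (0 + 1)) → CMType F := Fin.append Θ Θ'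
  have hA : blkA Ξ = Θ := blkA_append Θ Θ'
  obtain ⟨x₂, h0x, -, hax⟩ := U.transport_wvec hA.symm 0 S x
  have hx₂0 : x₂ ≠ 0 := fun h => hx0 (h0x.mpr h)
  obtain ⟨pA, pB, hP⟩ := U.blockPair_exists M.pull_id M.pull_comp M.lift F n 0 Ξ
  -- the top eigen-monomial `ω ≠ 0` of `Y'`
  obtain ⟨β, -, hβ⟩ := exists_integral_injective_eval F
  choose xB hxB _hx0 hsp using fun i => exists_eigenbasis M F (blkB Ξ i) β hβ
  have h2d : 2 * U.dim (U.cmProd F (blkB Ξ)) = Module.finrank ℚ F := by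
    have h := U.two_mul_dim_cmProd_of_dimProd M hd F (blkB Ξ)
    simpa using h
  have hdpos : 0 < U.dim (U.cmProd F (blkB Ξ)) := by
    have hF : 0 < Module.finrank ℚ F := Module.finrank_pos
    omega
  obtain ⟨K, hK⟩ : ∃ K, 2 * U.dim (U.cmProd F (blkB Ξ)) = K + 1 := ⟨2 * U.dim (U.cmProd F (blkB Ξ)) - 1, by omega⟩
  have hcard : Fintype.card (Fin (0 + 1) × ((F : Type) →+* ℂ)) = K + 1 := by
    rw [card_index]; simp only [zero_add, one_mul]; omega
  let q : Fin (K + 1) → Fin (0 + 1) × ((F : Type) →+* ℂ) := fun t => (Fintype.equivFin _).symm (finCongr hcard.symm t)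
  have hqb : Function.Bijective q := (Fintype.equivFin _).symm.bijective.comp (finCongr hcard.symm).bijective
  let ω : U.CohC (U.cmProd F (blkB Ξ)) (2 * U.dim (U.cmProd F (blkB Ξ))) := U.castC _ hK.symm (U.fmono xB K q)
  have hω0 : ω ≠ 0 := (LinearEquiv.map_ne_zero_iff _).mpr (U.fmono_ne_zero xB M hN1 hxB hsp hqb.1)
  have hωw : U.IsWeightVector F (blkB Ξ) (fun _ => Finset.univ) (2 * U.dim (U.cmProd F (blkB Ξ))) ω := by
    have h := isWeightVector_fmono xB M hxB K q hqb.1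
    rw [wtOf_eq_univ_of_surjective hqb.2] at h
    exact U.isWeightVector_castC F (blkB Ξ) _ hK.symm h
  -- `Z := p_Y^* x ∪ p_{Y'}^* ω ≠ 0`, of weight `((∅)_j, univ)`: character `0`, positive degree
  have hZ0 : U.cupC (U.cmProd F Ξ) (2 * 0) (2 * U.dim (U.cmProd F (blkB Ξ))) (U.pullC pA (2 * 0) x₂)
      (U.pullC pB (2 * U.dim (U.cmProd F (blkB Ξ))) ω) ≠ 0 :=
    fun h => hx₂0 (U.boxC_eq_zero Ξ M hN1 hd h7d hP hω0 h)
  have hxw0 : U.IsWeightVector F Ξ (fun _ => ∅) (2 * 0) (U.pullC pA (2 * 0) x₂) := isWeightVector_zero₄ h3 _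
  have hZw : U.IsWeightVector F Ξ
      (Fin.append (fun _ : Fin (n + 1) => (∅ : Finset ((F : Type) →+* ℂ))) (fun _ : Fin (0 + 1) => Finset.univ) :)
      (2 * 0 + 2 * U.dim (U.cmProd F (blkB Ξ)))
      (U.cupC (U.cmProd F Ξ) (2 * 0) (2 * U.dim (U.cmProd F (blkB Ξ))) (U.pullC pA (2 * 0) x₂)
        (U.pullC pB (2 * U.dim (U.cmProd F (blkB Ξ))) ω)) := by
    have h := U.isWeightVector_cupC_of_disjoint M.pull_cup (S := fun _ => ∅)
      (S' := (Fin.append (fun _ : Fin (n + 1) => (∅ : Finset ((F : Type) →+* ℂ)))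
        (fun _ : Fin (0 + 1) => Finset.univ) :))
      (fun _ => Finset.disjoint_empty_left _) hxw0 (U.isWeightVector_pullC_blkB Ξ M hN1 hP (by omega) hωw)
    simpa only [Finset.empty_union] using h
  have hdeg0 : 2 * 0 + 2 * U.dim (U.cmProd F (blkB Ξ)) = 2 * U.dim (U.cmProd F (blkB Ξ)) := by omega
  let Z : U.WVec F := ⟨n + 1 + 0, Ξ, U.dim (U.cmProd F (blkB Ξ)),
    (Fin.append (fun _ : Fin (n + 1) => (∅ : Finset ((F : Type) →+* ℂ))) (fun _ : Fin (0 + 1) => Finset.univ) :),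
    U.castC _ hdeg0 (U.cupC (U.cmProd F Ξ) (2 * 0) (2 * U.dim (U.cmProd F (blkB Ξ))) (U.pullC pA (2 * 0) x₂)
      (U.pullC pB (2 * U.dim (U.cmProd F (blkB Ξ))) ω)),
    fun h => hZ0 ((LinearEquiv.map_eq_zero_iff _).mp h), U.isWeightVector_castC F Ξ _ hdeg0 hZw⟩
  have hZa : Z.achar = 0 := by
    show lefChar Ξ (Fin.append (fun _ : Fin (n + 1) => (∅ : Finset ((F : Type) →+* ℂ)))
      (fun _ : Fin (0 + 1) => Finset.univ) :) = 0
    rw [lefChar_append, lefChar_univ_eq_zero, add_zero]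
    unfold lefChar
    simp
  have hZalg : Z.IsAlg := hpos F hG h6 Z hdpos hZa
  change U.castC _ hdeg0 (U.cupC (U.cmProd F Ξ) (2 * 0) (2 * U.dim (U.cmProd F (blkB Ξ))) (U.pullC pA (2 * 0) x₂)
      (U.pullC pB (2 * U.dim (U.cmProd F (blkB Ξ))) ω)) ∈ U.algC (U.cmProd F Ξ) (U.dim (U.cmProd F (blkB Ξ))) at hZalg
  -- descend: (b)_ℂ
  refine hax.mpr ?_
  have hA2 := (U.castC_mem_algC_iff (U.cmProd F Ξ) (show U.dim (U.cmProd F (blkB Ξ)) = 0 + U.dim (U.cmProd F (blkB Ξ))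
    by omega) (by omega) _).mpr hZalg
  rw [castC_castC] at hA2
  exact U.mem_algC_of_boxC_mem Ξ M hN1 hd h7d hP hω0 (by omega) hA2

/-! ## 5. The two trace-free routes to `Qw8Sufficiency` without N3 -/

/-- **Route (γ) = F7d.**  `Qw8Sufficiency` from `ModelAxioms`, N1, N2, N3-at-CM-products, F4, F5, F7d `Fact_gysinDescent`
and `Fact_dimProd` (compare `qw8Sufficiency_of_descentFacts₃`). -/
theorem qw8Sufficiency_of_descentFacts₄ (M : U.ModelAxioms) (hN1 : U.Fact_cupExterior) (hN2 : U.Fact_cup_hodge)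
    (h3 : U.Fact_pull_H0_cmProd) (h4 : U.Fact_cupAlg) (h5 : U.Fact_cupAssoc) (h7d : U.Fact_gysinDescent)
    (hd : U.Fact_dimProd) : U.Qw8Sufficiency :=
  have hpos := qw8MilnePos_of_facts₄ M hN1 hN2 h3 h4 h5
  have h0 := qw8MilneZero_of_descent₄ M hN1 h3 hd h7d hpos
  U.qw8Sufficiency_of_steps_pos (U.qw8ExtProdPos_of_descent M hN1 h4 h5 h7d hd)
    (U.qw8DualPushPullPos_of_descent M hN1 h4 h5 h7d hd) (qw8Milne_of_pos_of_zero hpos h0) h0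
    (qw8FaceBridge_holds M)

/-- `Qw8Milne` (all degrees) from `ModelAxioms`, N1, N2, N3-at-CM-products, F4, F5, F7d and `Fact_dimProd`. -/
theorem qw8Milne_of_descentFacts₄ (M : U.ModelAxioms) (hN1 : U.Fact_cupExterior) (hN2 : U.Fact_cup_hodge)
    (h3 : U.Fact_pull_H0_cmProd) (h4 : U.Fact_cupAlg) (h5 : U.Fact_cupAssoc) (h7d : U.Fact_gysinDescent)
    (hd : U.Fact_dimProd) : U.Qw8Milne :=
  have hpos := qw8MilnePos_of_facts₄ M hN1 hN2 h3 h4 h5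
  qw8Milne_of_pos_of_zero hpos (qw8MilneZero_of_descent₄ M hN1 h3 hd h7d hpos)

/-- **Route (δ) = F-H0 + F7d-B.**  `Qw8Sufficiency` from `ModelAxioms`, N1, N2, F4, F5, F-H0 `Fact_unitH0`, F7d-B
`Fact_gysinDescentB` and `Fact_dimProd` — NO N3-type binder (compare `qw8Sufficiency_of_unitH0₃`). -/
theorem qw8Sufficiency_of_unitH0₄ (M : U.ModelAxioms) (hN1 : U.Fact_cupExterior) (hN2 : U.Fact_cup_hodge)
    (h4 : U.Fact_cupAlg) (h5 : U.Fact_cupAssoc) (hu : U.Fact_unitH0) (hb : U.Fact_gysinDescentB)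
    (hd : U.Fact_dimProd) : U.Qw8Sufficiency :=
  qw8Sufficiency_of_descentFacts₄ M hN1 hN2 (fact_pull_H0_cmProd_of_unitH0 hu) h4 h5
    (gysinDescent_of_unitH0 M hN1 h5 hd hu hb) hd

/-- `Qw8Milne` from the same N3-free list. -/
theorem qw8Milne_of_unitH0₄ (M : U.ModelAxioms) (hN1 : U.Fact_cupExterior) (hN2 : U.Fact_cup_hodge)
    (h4 : U.Fact_cupAlg) (h5 : U.Fact_cupAssoc) (hu : U.Fact_unitH0) (hb : U.Fact_gysinDescentB)
    (hd : U.Fact_dimProd) : U.Qw8Milne :=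
  qw8Milne_of_descentFacts₄ M hN1 hN2 (fact_pull_H0_cmProd_of_unitH0 hu) h4 h5
    (gysinDescent_of_unitH0 M hN1 h5 hd hu hb) hd

end Universe

/-! ## 6. COR-CM without N3 -/

namespace Assembly

/-- **COR-CM, route (γ) = F7d, with N3 weakened to CM products**: `HC_CM` from `ModelAxioms`, the face realisation, N1, N2,
`Fact_pull_H0_cmProd`, F4, F5, F7d `Fact_gysinDescent` and `Fact_dimProd` (compare `COR_CM_of_descentFacts₃`). -/
theorem COR_CM_of_descentFacts₄ (U : Universe) (M : U.ModelAxioms) (hR : U.RealisationExistsFace)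
    (hN1 : U.Fact_cupExterior) (hN2 : U.Fact_cup_hodge) (h3 : U.Fact_pull_H0_cmProd) (h4 : U.Fact_cupAlg)
    (h5 : U.Fact_cupAssoc) (h7d : U.Fact_gysinDescent) (hd : U.Fact_dimProd) : U.HC_CM :=
  COR_CM U M hR (U.pohlmannSpan_of_facts₄ M hN1 hN2 h3)
    (U.qw8Sufficiency_of_descentFacts₄ M hN1 hN2 h3 h4 h5 h7d hd)

/-- **COR-CM, route (δ) = F-H0 + F7d-B, WITHOUT N3 (and without N4)** — the [QW8]-side end-to-end theorem with TEN
binders: `HC_CM ⇐ ModelAxioms ∧ RealisationExistsFace ∧ N1 ∧ N2 ∧ F4 ∧ F5 ∧ F-H0 ∧ F7d-B ∧ Fact_dimProd`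
(compare `COR_CM_of_descentFactsB₃`, eleven binders, and `COR_CM_of_descentFactsB`, twelve). -/
theorem COR_CM_of_descentFactsB₄ (U : Universe) (M : U.ModelAxioms) (hR : U.RealisationExistsFace)
    (hN1 : U.Fact_cupExterior) (hN2 : U.Fact_cup_hodge) (h4 : U.Fact_cupAlg) (h5 : U.Fact_cupAssoc)
    (hu : U.Fact_unitH0) (hb : U.Fact_gysinDescentB) (hd : U.Fact_dimProd) : U.HC_CM :=
  COR_CM_of_descentFacts₄ U M hR hN1 hN2 (Universe.fact_pull_H0_cmProd_of_unitH0 hu) h4 h5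
    (Universe.gysinDescent_of_unitH0 M hN1 h5 hd hu hb) hd

/-- The run-27 eleven-binder theorem is the ten-binder one with an ignored hypothesis `hN3`. -/
theorem COR_CM_of_descentFactsB₃_of₄ (U : Universe) (M : U.ModelAxioms) (hR : U.RealisationExistsFace)
    (hN1 : U.Fact_cupExterior) (hN2 : U.Fact_cup_hodge) (_hN3 : U.Fact_pull_H0) (h4 : U.Fact_cupAlg)
    (h5 : U.Fact_cupAssoc) (hu : U.Fact_unitH0) (hb : U.Fact_gysinDescentB) (hd : U.Fact_dimProd) : U.HC_CM :=
  COR_CM_of_descentFactsB₄ U M hR hN1 hN2 h4 h5 hu hb hd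

end Assembly

end HodgeCM

end
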